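import Summits.CriticalPhenomena.SAWScalingLimit.Theorems.SAWLeftRightFKGFKGToTraversalBoundOutlineFaces
import Literature.Probability.LatticeModels.RandomClusterBoxDuality
import HarnessLib

/-!
# Root-side contacts of a far-tip piece lie on one tour arc (witness unit U4, child side)

Crux `SAWLeftRightFKG.FKGToTraversalBound` (stmt-CriticalPhenomena-1878), line `slit-necklace`, lead
prover-line-stmt-CriticalPhenomena-1878-c5-0; witness unit U4 (child side of a far-tip piece), on top of the
vocabulary `…SlitNecklaceOutline` (`IsBEdge`, `bsite`, `bcontact`, `btour`) and `…OutlineFaces` (`cornerFace`,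
the wall-follower tour as a walk of faces).

Registered stub `btour_rootSide_dichotomy`.  Abstract lattice statement: `A ⊆ ℤ²` finite, `e₀` a boundary edge of
`A` whose tour has first return time `N` (no repeats before `N`), `e₁ = btour A e₀ n₁` with `0 < n₁ < N`; a lattice
walk `β` inside `A` from the outline site of `e₀` to that of `e₁`, and a lattice walk `ω` outside `A` from the
contact site of `e₀` to that of `e₁`.  Call a contact site of the tour ROOT-SIDE when it is joined to the site `z₀`
by a lattice walk avoiding `β` and `ω`.  Then root-side contacts cannot occur at positions of BOTH arcs `(0, n₁)`
and `(n₁, N)` of the tour.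

Proof (discrete planar topology by the tree's combinatorial winding number `walkWinding`, no Jordan curve
theorem).  Replace `β`, `ω` by paths (`Walk.bypass`) and close them up with the two tip edges into a closed
lattice TRAIL `Ψ` through `bcontact e₀ → bsite e₀ ⟶β bsite e₁ → bcontact e₁ ⟶ω⁻¹ bcontact e₀`.  The faces
`F j = cornerFace (btour A e₀ j)` form a face walk whose `j`-th step crosses exactly the primal edge
`{bsite, bcontact}` of position `j` (`sepEdge_cornerFace`); that edge joins `A` to its complement, so it is an
edge of `Ψ` only for the two tip positions `j = 0` and `j = n₁` (injectivity of the tour before `N`).  Hence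
`walkWinding Ψ ∘ F` is constant on `[1, n₁]` and on `[n₁ + 1, N]` (`walkWinding_closed_eq_of_adj`), while it
JUMPS across the tip edge of `e₀`, which `Ψ` uses exactly once (`walkWinding_sub_eq_of_vertical_mem` /
`…horizontal_mem`): the two arcs carry different winding numbers (`F N = F 0`).  A root-side contact at position
`j` reads the value of its arc: the face `F j` is a face around the contact site, which is off `Ψ`
(`walkWinding_eq_of_mem_corners`), and the winding number is constant along the avoiding walk to `z₀`
(`walkWinding_eq_of_walk_closed`).  Two root-side contacts on different arcs would give both arcs the value at
`z₀`, a contradiction.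

All statements folklore (boundary tracing of a polyomino; discrete winding numbers, Kesten, *Percolation theory
for mathematicians* (1982), §2.2, already formalised in `PlanarDuality.lean` / `RandomClusterBoxDuality.lean` /
`SquareTilingConjugate.lean`); no literature fact is introduced; nothing restates the crux.
-/

noncomputable section

open Set
open Literature.Probability.LatticeModels Literature.Probability.Percolation
open Literature.Probability.LatticeModels.SquareTiling (corners mem_corners_iff walkWinding_eq_of_walk_closed
  walkWinding_eq_of_mem_corners)

namespace Summit.CriticalPhenomena.SAWScalingLimit.Theorems.FKGToTraversalBound.SlitNecklace

/-! ### Small bookkeeping -/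

/-- A boundary edge is determined by its outline site and its contact site (a direction is determined by its
unit vector). [folklore] -/
private theorem side_eq_of_bsite_eq {e e' : Site 2 × ODir} (h₁ : bsite e = bsite e')
    (h₂ : bcontact e = bcontact e') : e = e' := by
  obtain ⟨x, d⟩ := e
  obtain ⟨x', d'⟩ := e'
  simp only [bsite] at h₁
  subst h₁
  simp only [bcontact, add_right_inj] at h₂
  have h0 := congrFun h₂ 0
  have h1 := congrFun h₂ 1
  fin_cases d <;> fin_cases d' <;> simp [ODir.vec] at h0 h1 ⊢

/-- The face step of a boundary edge crosses its primal edge `{bsite, bcontact}` (`sepEdge_cornerFace` for a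
pair not in constructor form). [folklore] -/
private theorem side_sepEdge_cornerFace (e : Site 2 × ODir) :
    sepEdge (cornerFace e) (cornerFace e + e.2.ccw.vec) = s(bsite e, bcontact e) := by
  obtain ⟨x, d⟩ := e
  exact sepEdge_cornerFace x d

/-- The start-corner face of a boundary edge is a face around its contact site. [folklore] -/
private theorem side_cornerFace_add_one_mem_corners (e : Site 2 × ODir) :
    cornerFace e + 1 ∈ corners (bcontact e) := by
  obtain ⟨x, d⟩ := e
  exact cornerFace_add_one_mem_corners_contact x d

/-- The face `q` is a face around the site `q` (its upper-right corner is `q + 1`). [folklore] -/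
private theorem side_add_one_mem_corners (q : Site 2) : q + 1 ∈ corners q := by
  rw [mem_corners_iff]
  simp

/-! ### Winding numbers of a closed trail about the tour faces -/

/-- **A closed trail winds differently about the two faces of an edge it uses.** [folklore] -/
private theorem side_walkWinding_ne_of_sepEdge_mem {a : Site 2} {p : (zdGraph 2).Walk a a}
    (hp : p.edges.Nodup) {z z' : Site 2} (hzz : (zdGraph 2).Adj z z') (h : sepEdge z z' ∈ p.edges) :
    walkWinding p z ≠ walkWinding p z' := by
  rcases stepKind_of_adj hzz with ⟨h0, h1⟩ | ⟨h0, h1⟩ | ⟨h1, h0⟩ | ⟨h1, h0⟩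
  · obtain rfl : z' = z + Pi.single 0 1 := by simp [Site.eq_iff_two, h0, h1]
    rw [sepEdge_right] at h
    rcases walkWinding_sub_eq_of_vertical_mem hp h with h' | h' <;> omega
  · obtain rfl : z = z' + Pi.single 0 1 := by simp [Site.eq_iff_two, h0, h1]
    rw [sepEdge_comm, sepEdge_right] at h
    rcases walkWinding_sub_eq_of_vertical_mem hp h with h' | h' <;> omega
  · obtain rfl : z' = z + Pi.single 1 1 := by simp [Site.eq_iff_two, h0, h1]
    rw [sepEdge_up] at h
    rcases walkWinding_sub_eq_of_horizontal_mem hp h with h' | h' <;> omega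
  · obtain rfl : z = z' + Pi.single 1 1 := by simp [Site.eq_iff_two, h0, h1]
    rw [sepEdge_comm, sepEdge_up] at h
    rcases walkWinding_sub_eq_of_horizontal_mem hp h with h' | h' <;> omega

/-- **Constancy along a tour arc.** If the closed walk `p` uses none of the primal edges of the tour positions
`i ≤ j < i + m`, it winds equally about the tour faces `cornerFace (btour A e₀ i)` and
`cornerFace (btour A e₀ (i + m))` (the tour is a face walk crossing exactly those edges). [folklore] -/
private theorem side_walkWinding_arc {a : Site 2} (p : (zdGraph 2).Walk a a) (A : Set (Site 2))
    (e₀ : Site 2 × ODir) {i : ℕ} :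
    ∀ {m : ℕ}, (∀ j, i ≤ j → j < i + m → s(bsite (btour A e₀ j), bcontact (btour A e₀ j)) ∉ p.edges) →
      walkWinding p (cornerFace (btour A e₀ (i + m))) = walkWinding p (cornerFace (btour A e₀ i)) := by
  intro m
  induction m with
  | zero => intro; rfl
  | succ m ih =>
    intro h
    rw [← add_assoc, cornerFace_btour_succ,
      ← walkWinding_closed_eq_of_adj (adj_cornerFace_add (btour A e₀ (i + m))) ?_]
    · exact ih fun j hj hj' => h j hj (by omega)
    · rw [side_sepEdge_cornerFace]
      exact h (i + m) le_self_add (by omega)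

/-- **A root-side contact reads the winding number at the root.** If a lattice walk from the contact site of
the boundary edge `e` to `z₀` avoids the closed walk `p`, then `p` winds equally about the start-corner face of
`e` and about the face `z₀`. [folklore] -/
private theorem side_walkWinding_cornerFace_eq {a : Site 2} (p : (zdGraph 2).Walk a a) (e : Site 2 × ODir)
    {z₀ : Site 2} (π : (zdGraph 2).Walk (bcontact e) z₀) (hπ : ∀ z ∈ π.support, z ∉ p.support) :
    walkWinding p (cornerFace e) = walkWinding p z₀ := by
  have hc : bcontact e ∉ p.support := hπ _ (SimpleGraph.Walk.start_mem_support π)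
  have h1 := walkWinding_eq_of_mem_corners p hc (side_cornerFace_add_one_mem_corners e)
  have h2 := walkWinding_eq_of_mem_corners p hc (side_add_one_mem_corners (bcontact e))
  rw [add_sub_cancel_right] at h1 h2
  rw [h1, ← h2]
  exact walkWinding_eq_of_walk_closed p π hπ

/-- **Core of the dichotomy**, for an abstract closed lattice trail `p` through the tip edge of `e₀` and through
no other primal edge of the tour positions `0 < j < N`, `j ≠ n₁`: contacts at positions `k ∈ (0, n₁)` and
`k' ∈ (n₁, N)` cannot both be joined to `z₀` off `p`. [folklore] -/
private theorem side_core {a : Site 2} (p : (zdGraph 2).Walk a a) (hp : p.edges.Nodup) (A : Set (Site 2))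
    (e₀ : Site 2 × ODir) {n₁ N k k' : ℕ} (hN : btour A e₀ N = e₀) (h0 : s(bsite e₀, bcontact e₀) ∈ p.edges)
    (hsep : ∀ j, 0 < j → j < N → j ≠ n₁ → s(bsite (btour A e₀ j), bcontact (btour A e₀ j)) ∉ p.edges)
    (hk0 : 0 < k) (hk1 : k < n₁) (hk'1 : n₁ < k') (hk'2 : k' < N) {z₀ : Site 2}
    (π : (zdGraph 2).Walk (bcontact (btour A e₀ k)) z₀) (hπ : ∀ z ∈ π.support, z ∉ p.support)
    (π' : (zdGraph 2).Walk (bcontact (btour A e₀ k')) z₀) (hπ' : ∀ z ∈ π'.support, z ∉ p.support) :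
    False := by
  -- both contacts read the value at the root
  have hk := side_walkWinding_cornerFace_eq p _ π hπ
  have hk' := side_walkWinding_cornerFace_eq p _ π' hπ'
  -- arc 1 carries the value of `F 1`, arc 2 that of `F N = F 0`
  obtain ⟨m, rfl⟩ : ∃ m, k = 1 + m := ⟨k - 1, by omega⟩
  have harc1 : walkWinding p (cornerFace (btour A e₀ (1 + m))) = walkWinding p (cornerFace (btour A e₀ 1)) :=
    side_walkWinding_arc p A e₀ fun j hj hj' => hsep j (by omega) (by omega) (by omega)
  obtain ⟨m', rfl⟩ : ∃ m', N = k' + m' := ⟨N - k', by omega⟩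
  have harc2 : walkWinding p (cornerFace (btour A e₀ (k' + m'))) =
      walkWinding p (cornerFace (btour A e₀ k')) :=
    side_walkWinding_arc p A e₀ fun j hj hj' => hsep j (by omega) hj' (by omega)
  rw [hN] at harc2
  -- the jump across the tip edge of `e₀`
  have hF1 : cornerFace (btour A e₀ 1) = cornerFace e₀ + e₀.2.ccw.vec := by
    simpa using cornerFace_btour_succ A e₀ 0
  have hjump : walkWinding p (cornerFace e₀) ≠ walkWinding p (cornerFace (btour A e₀ 1)) := by
    rw [hF1]
    refine side_walkWinding_ne_of_sepEdge_mem hp (adj_cornerFace_add e₀) ?_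
    rw [side_sepEdge_cornerFace]
    exact h0
  exact hjump (by rw [harc2, hk', ← hk, harc1])

/-! ### The registered stub -/

/-- **Registered stub (witness unit U4, child side of a far-tip piece): root-side contacts cannot occur on both
tour arcs between the tip edges.**  `A` is the free component of the far tip, `e₀` and `btour A e₀ n₁` its two tip
edges, `β` the middle of the piece (a chord of `A`), `ω` the outer barrier (outside `A`), `z₀` the root site; a
contact is root-side when joined to `z₀` by a lattice walk avoiding `β` and `ω`.  Proof: `side_core` applied to
the closed trail `bcontact e₀ → bsite e₀ ⟶ bsite e₁ → bcontact e₁ ⟶ bcontact e₀` through the bypasses of `β`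
and `ω`. [folklore] -/
theorem btour_rootSide_dichotomy : ∀ (A : Finset (Site 2)) (e₀ : Site 2 × ODir) (n₁ N : ℕ) (β : (zdGraph 2).Walk (bsite e₀) (bsite (btour (↑A : Set (Site 2)) e₀ n₁))) (ω : (zdGraph 2).Walk (bcontact e₀) (bcontact (btour (↑A : Set (Site 2)) e₀ n₁))) (z₀ : Site 2), IsBEdge (↑A : Set (Site 2)) e₀ → 0 < n₁ → n₁ < N → btour (↑A : Set (Site 2)) e₀ N = e₀ → (∀ j j', j < N → j' < N → btour (↑A : Set (Site 2)) e₀ j = btour (↑A : Set (Site 2)) e₀ j' → j = j') → (∀ z ∈ β.support, z ∈ A) → (∀ z ∈ ω.support, z ∉ A) → z₀ ∉ β.support → z₀ ∉ ω.support → (∃ k, 0 < k ∧ k < n₁ ∧ ∃ π : (zdGraph 2).Walk (bcontact (btour (↑A : Set (Site 2)) e₀ k)) z₀, ∀ z ∈ π.support, z ∉ β.support ∧ z ∉ ω.support) → (∃ k', n₁ < k' ∧ k' < N ∧ ∃ π : (zdGraph 2).Walk (bcontact (btour (↑A : Set (Site 2)) e₀ k')) z₀, ∀ z ∈ π.support,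 z ∉ β.support ∧ z ∉ ω.support) → False := by
  classical
  intro A e₀ n₁ N β ω z₀ he₀ hn₁ hn₁N hN hinj hβ hω _ _ hk hk'
  obtain ⟨k, hk0, hk1, π, hπ⟩ := hk
  obtain ⟨k', hk'1, hk'2, π', hπ'⟩ := hk'
  have he₀' := bcontact_spec _ he₀
  have he₁' := bcontact_spec _ (btour_isBEdge (↑A : Set (Site 2)) he₀ n₁)
  have hβA : ∀ z ∈ β.bypass.support, z ∈ A := fun z hz => hβ z (β.support_bypass_subset_support hz)
  have hωA : ∀ z ∈ ω.bypass.support, z ∉ A := fun z hz => hω z (ω.support_bypass_subset_support hz)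
  -- the closed trail through the two tip edges
  set Ψ : (zdGraph 2).Walk (bcontact e₀) (bcontact e₀) :=
    SimpleGraph.Walk.cons he₀'.2.2.symm (β.bypass.append (SimpleGraph.Walk.cons he₁'.2.2 ω.bypass.reverse))
    with hΨ
  have hΨs : ∀ z ∈ Ψ.support, z ∈ β.support ∨ z ∈ ω.support := by
    intro z hz
    simp only [hΨ, SimpleGraph.Walk.support_cons, SimpleGraph.Walk.support_append,
      SimpleGraph.Walk.support_reverse, List.tail_cons, List.mem_cons, List.mem_append,
      List.mem_reverse] at hz
    rcases hz with rfl | hz | hz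
    · exact Or.inr (SimpleGraph.Walk.start_mem_support ω)
    · exact Or.inl (β.support_bypass_subset_support hz)
    · exact Or.inr (ω.support_bypass_subset_support hz)
  have hΨe : ∀ s ∈ Ψ.edges, s = s(bcontact e₀, bsite e₀) ∨ s ∈ β.bypass.edges ∨
      s = s(bsite (btour (↑A : Set (Site 2)) e₀ n₁), bcontact (btour (↑A : Set (Site 2)) e₀ n₁)) ∨
        s ∈ ω.bypass.edges := by
    intro s hs
    simp only [hΨ, SimpleGraph.Walk.edges_cons, SimpleGraph.Walk.edges_append,
      SimpleGraph.Walk.edges_reverse, List.mem_cons, List.mem_append, List.mem_reverse] at hs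
    tauto
  -- the two tip edges differ (the tour does not repeat before `N`)
  have htip : s(bcontact e₀, bsite e₀) ≠
      s(bsite (btour (↑A : Set (Site 2)) e₀ n₁), bcontact (btour (↑A : Set (Site 2)) e₀ n₁)) := by
    intro h
    rcases Sym2.eq_iff.1 h with ⟨h1, -⟩ | ⟨h1, h2⟩
    · exact he₀'.2.1 (h1 ▸ he₁'.1)
    · have := hinj 0 n₁ (by omega) hn₁N (by simpa using side_eq_of_bsite_eq h2 h1)
      omega
  -- `Ψ` is a trail
  have hnd : Ψ.edges.Nodup := by
    rw [hΨ, SimpleGraph.Walk.edges_cons, List.nodup_cons, SimpleGraph.Walk.edges_append,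
      SimpleGraph.Walk.edges_cons, SimpleGraph.Walk.edges_reverse]
    refine ⟨fun h => ?_, List.nodup_append.2 ⟨β.bypass_isPath.isTrail.edges_nodup,
      List.nodup_cons.2 ⟨fun h => ?_, List.nodup_reverse.2 ω.bypass_isPath.isTrail.edges_nodup⟩, ?_⟩⟩
    · rcases List.mem_append.1 h with h | h
      · exact he₀'.2.1 (hβA _ (β.bypass.fst_mem_support_of_mem_edges h))
      · rcases List.mem_cons.1 h with h | h
        · exact htip h
        · exact hωA _ (ω.bypass.snd_mem_support_of_mem_edges (List.mem_reverse.1 h)) he₀'.1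
    · exact hωA _ (ω.bypass.fst_mem_support_of_mem_edges (List.mem_reverse.1 h)) he₁'.1
    · rintro s hs _ hs' rfl
      rcases List.mem_cons.1 hs' with rfl | hs'
      · exact he₁'.2.1 (hβA _ (β.bypass.snd_mem_support_of_mem_edges hs))
      · induction s using Sym2.ind with
        | _ u v =>
          exact hωA u (ω.bypass.fst_mem_support_of_mem_edges (List.mem_reverse.1 hs'))
            (hβA u (β.bypass.fst_mem_support_of_mem_edges hs))
  -- `Ψ` uses the tip edge of `e₀` …
  have h0 : s(bsite e₀, bcontact e₀) ∈ Ψ.edges := by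
    rw [hΨ, SimpleGraph.Walk.edges_cons, Sym2.eq_swap]
    exact List.mem_cons_self
  -- … and no other primal edge of the tour, except that of position `n₁`
  have hsep : ∀ j, 0 < j → j < N → j ≠ n₁ →
      s(bsite (btour (↑A : Set (Site 2)) e₀ j), bcontact (btour (↑A : Set (Site 2)) e₀ j)) ∉ Ψ.edges := by
    intro j hj0 hjN hjn hmem
    have hej := bcontact_spec _ (btour_isBEdge (↑A : Set (Site 2)) he₀ j)
    rcases hΨe _ hmem with h | h | h | h
    · rcases Sym2.eq_iff.1 h with ⟨h1, -⟩ | ⟨h1, h2⟩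
      · exact he₀'.2.1 (h1 ▸ hej.1)
      · have := hinj j 0 hjN (by omega) (by simpa using side_eq_of_bsite_eq h1 h2)
        omega
    · exact hej.2.1 (hβA _ (β.bypass.snd_mem_support_of_mem_edges h))
    · rcases Sym2.eq_iff.1 h with ⟨h1, h2⟩ | ⟨h1, -⟩
      · exact hjn (hinj j n₁ hjN hn₁N (side_eq_of_bsite_eq h1 h2))
      · exact he₁'.2.1 (h1 ▸ hej.1)
    · exact hωA _ (ω.bypass.fst_mem_support_of_mem_edges h) hej.1
  -- the root-side walks avoid `Ψ`
  have hπΨ : ∀ z ∈ π.support, z ∉ Ψ.support := fun z hz hzΨ =>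
    (hΨs z hzΨ).elim (hπ z hz).1 (hπ z hz).2
  have hπ'Ψ : ∀ z ∈ π'.support, z ∉ Ψ.support := fun z hz hzΨ =>
    (hΨs z hzΨ).elim (hπ' z hz).1 (hπ' z hz).2
  exact side_core Ψ hnd (↑A : Set (Site 2)) e₀ hN h0 hsep hk0 hk1 hk'1 hk'2 π hπΨ π' hπ'Ψ

end Summit.CriticalPhenomena.SAWScalingLimit.Theorems.FKGToTraversalBound.SlitNecklace

end
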